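import Summits.Ventures.CertifiedArithmetic.LowPrec.DoubleRoundingFMANearWideFrame

/-!
# Double rounding of the FMA through a register with `P_ψ = 3 P_φ - 1` — soundness of the test

HONEST FRAMING: certified error envelopes and provably optimal rounding/accumulation schemes for
low-precision formats under stated cost models; every table by two implementations; no hardware
or vendor claims.

THEOREM D-fma-W′ (soundness half): for format records with `F_φ ⊆ F_ψ`, `m_ψ = 3 m_φ + 1`
(`P_ψ = 3 P_φ - 1`, the first register width below the scope `P_ψ ≥ 3 P_φ` of THEOREM D-fma-W),
`bias_φ ≤ bias_ψ`, `L_ψ ≤ 2 L_φ`, `L_ψ + P_ψ ≤ L_φ` and `m_φ ≥ 1`, the Boolean test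
`fmaNearWideTest φ ψ` implies `DFma φ ψ`: one FMA in `ψ` converted to `φ` is the correctly rounded
FMA of `φ` on all of `F_φ³`.  The test reads: (A) no midpoint of `φ` available in the binades
`≥ 2^(m_ψ+1)` quanta has a composite significand (pattern A1, as in D-fma-W) or an A2 number
`fmaTieSig` that is a product of two significands; (B′) not both "`2^(2P_φ-1) ∓ 1` is a product of
two significands" and "the binade `(m_φ+2) ∸ bias_φ` of the midpoint frame has a finite second
value".  The slip frame is `nearWide_slip_sig`; here the record-level tests exclude its three
patterns, and the sign symmetry of round-to-nearest-even finishes.  The converse (witnesses) and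
the `iff` are the `…Witness` / `…Iff` files.  Implementation A = `code/enum/fma_nearwide_law.py`
(certificate `DOUBLE-ROUNDING-FMA-NEARWIDE.json`; the two implementations agree on every pair of
the census and on the named cells).

References: [MartinDorelMelquiondMuller2013] Property 2.1; [BoldoMelquiond2008] Thm 3;
[Figueroa1995] §3; [Roux2014] §2.  No hardware or vendor claims.
-/

namespace Summit.Ventures.CertifiedArithmetic

open Literature.ComputerArithmetic.FloatingPoint
open Literature.ComputerArithmetic.FloatingPoint.Format
open Literature.ComputerArithmetic.FloatingPoint.MiniFloat

/-- THEOREM D-fma-W′ (positive case, both factors nonzero): under the frame hypotheses and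
`fmaNearWideTest φ ψ`, `fl_φ(fl_ψ(a·b + c)) = fl_φ(a·b + c)` for `a·b + c > 0`. [this packet] -/
theorem dFma_nearWide_pos {φ ψ : Format} (hE : embedsTest φ ψ = true)
    (hm : ψ.manBits = 3 * φ.manBits + 1) (hb : φ.bias ≤ ψ.bias)
    (hq2 : ψ.qexp ≤ 2 * φ.qexp) (hnorm : ψ.qexp + ψ.manBits + 1 ≤ φ.qexp) (h1 : 1 ≤ φ.manBits)
    (hW : fmaNearWideTest φ ψ = true) {a b c : MiniFloat φ} (ha : a.scaledMag ≠ 0)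
    (hb0 : b.scaledMag ≠ 0) (hx : 0 < a.toRat * b.toRat + c.toRat) :
    (roundNE φ (roundNE ψ (a.toRat * b.toRat + c.toRat)).toRat).toRat
      = (roundNE φ (a.toRat * b.toRat + c.toRat)).toRat := by
  by_contra h
  obtain ⟨v, a₁, b₁, he1, hu, ha₁, hb₁, ha₁lt, hb₁lt, hcase⟩ :=
    nearWide_slip_sig hE hm hb hq2 hnorm h1 ha hb0 hx h
  have hW' := hW
  simp only [fmaNearWideTest, Bool.and_eq_true] at hW'
  obtain ⟨hWA, hWB⟩ := hW'
  have ha0 : 0 < a₁ := by have := Nat.odd_iff.mp ha₁; omega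
  rcases hcase with ⟨hwin, hsig⟩ | ⟨hrange, hsig⟩
  · -- patterns (A1)/(A2): the midpoint `j = man v` is available and excluded by the A-test
    have hcount := man_lt_fmaWideCount v he1 hwin hu
    have hall : ∀ j ∈ List.range (fmaWideCount φ ψ),
        (! sigPairTest (φ.manBits + 1) (2 ^ (φ.manBits + 1) + 2 * j + 1)
          && ! twoSigTest (φ.manBits + 1) (fmaTieSig φ.manBits (2 ^ φ.manBits + j))) = true := by
      have h2 := hWA; unfold fmaNearWideATest at h2; exact List.all_eq_true.mp h2
    have hj := hall v.man (List.mem_range.mpr hcount)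
    simp only [Bool.and_eq_true, Bool.not_eq_true'] at hj
    obtain ⟨hA1, hA2⟩ := hj
    rcases hsig with hO | hO
    · -- (A1): `a₁ b₁ = 2^P + 2 man + 1` is composite with both factors `> 1`
      have hman := v.man_lt
      have ha1 : 1 < a₁ := by
        by_contra h1'
        have : a₁ = 1 := by obtain ⟨i, hi⟩ := ha₁; omega
        rw [this, one_mul] at hO; omega
      have hb1 : 1 < b₁ := by
        by_contra h1'
        have : b₁ = 1 := by obtain ⟨i, hi⟩ := hb₁; omega
        rw [this, mul_one] at hO; omega
      have hOlt : a₁ * b₁ < 2 ^ (φ.manBits + 1 + 1) := by rw [hO, pow_succ]; omega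
      rw [← hO, sigPairTest_mul_eq_true ha1 hb1 hOlt] at hA1
      exact Bool.noConfusion hA1
    · -- (A2): the A2 number is the product `a₁ b₁` of two significands
      rw [← hO, twoSigTest_mul_eq_true ha0 ha₁lt hb₁lt] at hA2
      exact Bool.noConfusion hA2
  · -- pattern (B′): `2^(2P-1) ∓ 1 = a₁ b₁` and the binade `(m+2) ∸ bias` has a finite second value
    have hT : (twoSigTest (φ.manBits + 1) (2 ^ (2 * (φ.manBits + 1) - 1) - 1)
        || twoSigTest (φ.manBits + 1) (2 ^ (2 * (φ.manBits + 1) - 1) + 1)) = true := by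
      rcases hsig with hO | hO
      · rw [← hO, twoSigTest_mul_eq_true ha0 ha₁lt hb₁lt, Bool.true_or]
      · rw [← hO, twoSigTest_mul_eq_true ha0 ha₁lt hb₁lt, Bool.or_true]
    have hR : (2 ^ φ.manBits + 1) * 2 ^ (φ.manBits + 3 - φ.bias) ≤ φ.maxScaled :=
      le_trans (Nat.mul_le_mul (by omega) (Nat.pow_le_pow_right (by norm_num) hrange)) hu
    have h2 := hWB
    unfold fmaNearWideBTest at h2
    rw [hT, decide_eq_true hR] at h2
    exact Bool.noConfusion h2

/-- THEOREM D-fma-W′ (soundness), every pair of format records: `F_φ ⊆ F_ψ`, `m_ψ = 3 m_φ + 1`,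
`bias_φ ≤ bias_ψ`, `L_ψ ≤ 2 L_φ`, `L_ψ + P_ψ ≤ L_φ`, `m_φ ≥ 1` and `fmaNearWideTest φ ψ` imply
`DFma φ ψ`.  Implementation A = `code/enum/fma_nearwide_law.py`. [this packet] -/
theorem dFma_of_fmaNearWideTest {φ ψ : Format} (hE : embedsTest φ ψ = true)
    (hm : ψ.manBits = 3 * φ.manBits + 1) (hb : φ.bias ≤ ψ.bias)
    (hq2 : ψ.qexp ≤ 2 * φ.qexp) (hnorm : ψ.qexp + ψ.manBits + 1 ≤ φ.qexp) (h1 : 1 ≤ φ.manBits)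
    (hW : fmaNearWideTest φ ψ = true) : DFma φ ψ := by
  intro a b c
  by_cases hab : a.scaledMag = 0 ∨ b.scaledMag = 0
  · have h0 : a.toRat * b.toRat = 0 := by
      rcases hab with h0 | h0 <;>
        simp [toRat_eq_toInt_mul a, toRat_eq_toInt_mul b, MiniFloat.toInt, h0]
    rw [h0, zero_add]
    exact toRat_roundNE_roundNE_of_exists (embeds_of_test hE c)
  simp only [not_or] at hab
  rcases lt_trichotomy (a.toRat * b.toRat + c.toRat) 0 with hneg | h0 | hpos
  · have h := dFma_nearWide_pos hE hm hb hq2 hnorm h1 hW (a := a.flipSign) (b := b)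
      (c := c.flipSign) hab.1 hab.2 (by simp only [toRat_flipSign]; linarith)
    simp only [toRat_flipSign] at h
    have e : -a.toRat * b.toRat + -c.toRat = -(a.toRat * b.toRat + c.toRat) := by ring
    rwa [e, toRat_roundNE_neg, toRat_roundNE_neg, toRat_roundNE_neg, neg_inj] at h
  · simp only [h0, toRat_roundNE_zero]
  · exact dFma_nearWide_pos hE hm hb hq2 hnorm h1 hW hab.1 hab.2 hpos

/-- The packaged test `dFmaNearWideTest` is sound for EVERY pair of records. [this packet] -/
theorem dFma_of_nearWideTest {φ ψ : Format} (h : dFmaNearWideTest φ ψ = true) : DFma φ ψ := by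
  simp only [dFmaNearWideTest, Bool.and_eq_true, decide_eq_true_eq] at h
  obtain ⟨⟨⟨⟨⟨⟨hE, hm⟩, hb⟩, hq⟩, hn⟩, h1⟩, hW⟩ := h
  exact dFma_of_fmaNearWideTest hE hm hb hq hn h1 hW

end Summit.Ventures.CertifiedArithmetic
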